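import Summits.RiemannHypothesis.RiemannHypothesis.Theorems.WeilColumnThetaPrimeTail
import HarnessLib

/-!
# THETA kernel certificate, analytic layer D6: the cross sum WITHOUT Rosser–Schoenfeld — Chebyshev's bound suffices (RH-FREE, UNCONDITIONAL)

Cell `rh-explicit`, WEIL column, seat handoff-prove-2 gen12.  `WeilColumnThetaPrimeTail.vonMangoldt_logTail_sum_le` bounds the cross sum
of THETA-CERT-cc6 §D6 under the HYPOTHESIS `ψ(x) ≤ C·x` for all `x ≥ 0` (Rosser–Schoenfeld: `C = 1.03883`, an unproved named fact in this
tree).  Two observations make the bound UNCONDITIONAL: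

1. the partial summation only ever evaluates `ψ` on `[N, b]`, so `ψ(x) ≤ C·x` is needed only for `x ≥ N`
   (`vonMangoldt_logTail_sum_le_of_ge`, same proof);
2. Mathlib PROVES `Chebyshev.psi_le : ψ(x) ≤ log 4·x + 2√x·log x` (`x ≥ 1`), and `log x/√x` is decreasing on `[e², ∞)`, so for
   `N ≥ e²` and `x ≥ N`: **`ψ(x) ≤ (log 4 + 2·log N/√N)·x`** (`psi_le_cheb_linear`).

Hence **`vonMangoldt_logTail_sum_le_cheb`**: for `m ≥ 1`, `N ≥ e²` and every `K`,
`Σ_{n<K} Λ(n)·max 0 (log n − log N)/n^{m+1} ≤ (log 4 + 2·log N/√N)·(e^{−m/(m+1)}/(m+1) + 1/m²)/N^m` — NO hypothesis.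
For the tier-1 rows (`N = q·e^{2δ−2η}`, `80 ≤ q < 6·10⁴`) the constant is `1.48 … 2.3` instead of `1.03883`; the seat's run of cc-s2-1's
Python twin of the checker with this row-wise constant still passes ALL 5 232 tier-1 rows (worst relative margin 0.090 at q = 59 743;
DERIVED-FLOAT, HOME/handoff/prove-2/ATTEMPT-22.md §5).  Nothing here bears on the truth of RH.
-/

noncomputable section

set_option linter.dupNamespace false

open Set MeasureTheory Filter Finset
open scoped Real Topology ArithmeticFunction.vonMangoldt Chebyshev

namespace Summit.RiemannHypothesis.RiemannHypothesis.Theorems.WeilColumn.ThetaPrime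

variable {N C : ℝ} {m : ℕ}

/-! ## §1 The partial summation with `ψ ≤ C·x` only beyond `N` (proofs verbatim from `WeilColumnThetaPrimeTail`) -/

/-- **Abel step, hypothesis only beyond `N`.**  For `0 < N ≤ b`, `ψ(x) ≤ C·x` for `x ≥ N`:
`Σ_{k ∈ Ioc ⌊N⌋ ⌊b⌋} f(k)Λ(k) ≤ C·(b f(b) + ∫_{(N,b]} t·max 0 (−f′(t)) dt)`. -/
theorem abel_logTail_le_of_ge (hN : 0 < N) {b : ℝ} (hNb : N ≤ b) (hC : 0 ≤ C)
    (hψ : ∀ x : ℝ, N ≤ x → ψ x ≤ C * x) :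
    ∑ k ∈ Ioc ⌊N⌋₊ ⌊b⌋₊, (Real.log k - Real.log N) / (k : ℝ) ^ (m + 1) * (Λ k : ℝ) ≤
      C * (b * ((Real.log b - Real.log N) / b ^ (m + 1)) +
        ∫ t in Ioc N b, t * max 0 (-((1 - ((m : ℝ) + 1) * (Real.log t - Real.log N)) / t ^ (m + 2)))) := by
  set f : ℝ → ℝ := fun t ↦ (Real.log t - Real.log N) / t ^ (m + 1) with hf
  set f' : ℝ → ℝ := fun t ↦ (1 - ((m : ℝ) + 1) * (Real.log t - Real.log N)) / t ^ (m + 2) with hf'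
  have hderiv : ∀ t, 0 < t → HasDerivAt f (f' t) t := fun t ht ↦ hasDerivAt_logTail ht N m
  have hdiff : ∀ t ∈ Set.Icc N b, DifferentiableAt ℝ f t :=
    fun t ht ↦ (hderiv t (hN.trans_le ht.1)).differentiableAt
  have hderiv_eq : ∀ t ∈ Set.Icc N b, deriv f t = f' t := fun t ht ↦ (hderiv t (hN.trans_le ht.1)).deriv
  -- continuity of `f'` and of the majorant on `[N, b]`
  have hf'cont : ContinuousOn f' (Set.Icc N b) := by
    rw [hf']
    refine ContinuousOn.div ?_ (by fun_prop) fun t ht ↦ pow_ne_zero _ (hN.trans_le ht.1).ne'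
    refine continuousOn_const.sub (continuousOn_const.mul ((Real.continuousOn_log.mono ?_).sub continuousOn_const))
    intro t ht; exact (hN.trans_le ht.1).ne'
  have hint : IntegrableOn (deriv f) (Set.Icc N b) :=
    (hf'cont.integrableOn_Icc).congr_fun (fun t ht ↦ (hderiv_eq t ht).symm) measurableSet_Icc
  -- Abel summation
  have habel := sum_mul_eq_sub_sub_integral_mul (fun k ↦ (Λ k : ℝ)) hN.le hNb hdiff hint
  simp only [sum_Icc_vonMangoldt_eq_psi] at habel
  have hfN : f N = 0 := by simp [hf]
  rw [habel, hfN, zero_mul, sub_zero]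
  -- the boundary term
  have hb0 : 0 < b := hN.trans_le hNb
  have hfb0 : 0 ≤ f b := by
    rw [hf]; exact div_nonneg (by linarith [Real.log_le_log hN hNb]) (by positivity)
  have h1 : f b * ψ b ≤ C * (b * f b) := by
    have := hψ b hNb
    nlinarith [Chebyshev.psi_nonneg b]
  -- the integral term
  have hmajcont : ContinuousOn (fun t : ℝ ↦ t * max 0 (-f' t)) (Set.Icc N b) :=
    continuousOn_id.mul (continuousOn_const.sup hf'cont.neg)
  have hI1 : IntegrableOn (fun t ↦ deriv f t * ψ t) (Set.Ioc N b) := by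
    have := integrableOn_mul_sum_Icc (fun k ↦ (Λ k : ℝ)) (m := 0) hN.le hint
    simp only [sum_Icc_vonMangoldt_eq_psi] at this
    exact this.mono_set Set.Ioc_subset_Icc_self
  have h2 : -(∫ t in Set.Ioc N b, deriv f t * ψ t) ≤ ∫ t in Set.Ioc N b, C * (t * max 0 (-f' t)) := by
    rw [← integral_neg]
    refine setIntegral_mono_on hI1.neg ((hmajcont.integrableOn_Icc.mono_set Set.Ioc_subset_Icc_self).const_mul C)
      measurableSet_Ioc fun t ht ↦ ?_
    have ht0 : 0 < t := hN.trans ht.1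
    rw [hderiv_eq t ⟨ht.1.le, ht.2⟩]
    have hψ0 := Chebyshev.psi_nonneg t
    have hψt := hψ t ht.1.le
    by_cases hs : 0 ≤ f' t
    · have : 0 ≤ C * (t * max 0 (-f' t)) := mul_nonneg hC (mul_nonneg ht0.le (le_max_left _ _))
      nlinarith
    · have hs' : f' t < 0 := lt_of_not_ge hs
      rw [max_eq_right (by linarith)]
      nlinarith
  rw [integral_const_mul] at h2
  have : f b * ψ b - ∫ t in Set.Ioc N b, deriv f t * ψ t ≤ C * (b * f b) + C * ∫ t in Set.Ioc N b, t * max 0 (-f' t) := by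
    linarith
  simpa [hf, hf', mul_add] using this

/-! ## §4 The bound on `Σ_{N<n≤b} Λ(n)f(n)` and on the finite cross sums -/

/-- **`Σ_{k ∈ Ioc ⌊N⌋ ⌊b⌋} f(k)Λ(k) ≤ C·(e^{−m/(m+1)}/(m+1) + 1/m²)/N^m`** for `0 < N ≤ b`, `m ≥ 1`, `ψ(x) ≤ C·x` beyond `N`. -/
theorem sum_Ioc_logTail_vonMangoldt_le_of_ge (hm : 1 ≤ m) (hN : 0 < N) {b : ℝ} (hNb : N ≤ b) (hC : 0 ≤ C)
    (hψ : ∀ x : ℝ, N ≤ x → ψ x ≤ C * x) :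
    ∑ k ∈ Ioc ⌊N⌋₊ ⌊b⌋₊, (Real.log k - Real.log N) / (k : ℝ) ^ (m + 1) * (Λ k : ℝ) ≤
      C * (Real.exp (-((m : ℝ) / ((m : ℝ) + 1))) / ((m : ℝ) + 1) + 1 / (m : ℝ) ^ 2) / N ^ m := by
  have hm0 : (0 : ℝ) < m := by exact_mod_cast hm
  have hm1 : (0 : ℝ) < (m : ℝ) + 1 := by positivity
  have hb0 : 0 < b := hN.trans_le hNb
  have habel := abel_logTail_le_of_ge (m := m) hN hNb hC hψ
  set xs := N * Real.exp (1 / ((m : ℝ) + 1)) with hxs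
  have hxs0 : 0 < xs := by positivity
  -- values at `x*` and signs
  have hlogxs : Real.log xs - Real.log N = 1 / ((m : ℝ) + 1) := by
    rw [hxs, Real.log_mul hN.ne' (Real.exp_pos _).ne', Real.log_exp]; ring
  have hxsm : xs ^ m = N ^ m * Real.exp ((m : ℝ) / ((m : ℝ) + 1)) := by
    rw [hxs, mul_pow, ← Real.exp_nat_mul]; congr 2; field_simp
  have hE : Real.exp (-((m : ℝ) / ((m : ℝ) + 1))) = (Real.exp ((m : ℝ) / ((m : ℝ) + 1)))⁻¹ := Real.exp_neg _
  have hNm : 0 < N ^ m := pow_pos hN m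
  have hem : 0 < Real.exp ((m : ℝ) / ((m : ℝ) + 1)) := Real.exp_pos _
  -- the target quantity
  set R := C * (Real.exp (-((m : ℝ) / ((m : ℝ) + 1))) / ((m : ℝ) + 1) + 1 / (m : ℝ) ^ 2) / N ^ m with hR
  by_cases hcase : b ≤ xs
  · -- near case: the integral vanishes, `b f(b) ≤ x* f(x*)`
    rw [integral_majorant_eq_zero_of_le hN hcase, add_zero] at habel
    have hnear := mul_logTail_le_near hN hNb hcase
    refine habel.trans ?_
    calc C * (b * ((Real.log b - Real.log N) / b ^ (m + 1)))
        ≤ C * (Real.exp (-((m : ℝ) / ((m : ℝ) + 1))) / (((m : ℝ) + 1) * N ^ m)) :=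
          mul_le_mul_of_nonneg_left hnear hC
      _ ≤ R := by
          rw [hR, mul_div_assoc]
          refine mul_le_mul_of_nonneg_left ?_ hC
          rw [div_mul_eq_div_div]
          exact div_le_div_of_nonneg_right (le_add_of_nonneg_right (by positivity)) hNm.le
  · -- far case: by parts on `[x*, b]`
    have hb : xs ≤ b := le_of_not_ge hcase
    rw [integral_majorant_eq_of_ge hm hN hb] at habel
    rw [← hxs] at habel
    rw [hlogxs] at habel
    refine habel.trans ?_
    -- `F(b) ≤ 0`
    have hFb : -(Real.log b - Real.log N + 1 / m) / ((m : ℝ) * b ^ m) ≤ 0 :=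
      div_nonpos_of_nonpos_of_nonneg (by linarith [Real.log_le_log hN hNb, one_div_pos.2 hm0]) (by positivity)
    -- `−F(x*) ≤ 1/(m² N^m)`
    have hFxs : -(-(1 / ((m : ℝ) + 1) + 1 / m) / ((m : ℝ) * xs ^ m)) ≤ 1 / ((m : ℝ) ^ 2 * N ^ m) := by
      rw [neg_div, neg_neg, hxsm]
      have h := exp_neg_mul_le_inv hm
      rw [hE] at h
      rw [div_le_div_iff₀ (by positivity) (by positivity)]
      have : (1 / ((m : ℝ) + 1) + 1 / m) * ((m : ℝ) ^ 2 * N ^ m) =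
          ((Real.exp ((m : ℝ) / ((m : ℝ) + 1)))⁻¹ * (1 / ((m : ℝ) + 1) + 1 / m)) *
            ((m : ℝ) * (N ^ m * Real.exp ((m : ℝ) / ((m : ℝ) + 1))) * m) := by
        field_simp
      rw [this]
      calc _ ≤ (1 / (m : ℝ)) * ((m : ℝ) * (N ^ m * Real.exp ((m : ℝ) / ((m : ℝ) + 1))) * m) :=
            mul_le_mul_of_nonneg_right h (by positivity)
        _ = 1 * ((m : ℝ) * (N ^ m * Real.exp ((m : ℝ) / ((m : ℝ) + 1)))) := by field_simp
    -- `x* f(x*)` value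
    have hxsf : -(1 / ((m : ℝ) + 1)) / xs ^ m = -(Real.exp (-((m : ℝ) / ((m : ℝ) + 1))) / (((m : ℝ) + 1) * N ^ m)) := by
      rw [hxsm, hE]; field_simp
    -- assemble: C·(b f b + (G b − G x*)) = C·(x* f x* + F b − F x*)
    have hbf : b * ((Real.log b - Real.log N) / b ^ (m + 1)) = (Real.log b - Real.log N) / b ^ m := by
      rw [pow_succ]; field_simp
    rw [hbf, hxsf]
    have hsum : (Real.log b - Real.log N) / b ^ m +
        ((-(Real.log b - Real.log N) / b ^ m + -(Real.log b - Real.log N + 1 / m) / ((m : ℝ) * b ^ m)) -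
          (-(Real.exp (-((m : ℝ) / ((m : ℝ) + 1))) / (((m : ℝ) + 1) * N ^ m)) +
            -(1 / ((m : ℝ) + 1) + 1 / m) / ((m : ℝ) * xs ^ m))) ≤
        Real.exp (-((m : ℝ) / ((m : ℝ) + 1))) / (((m : ℝ) + 1) * N ^ m) + 1 / ((m : ℝ) ^ 2 * N ^ m) := by
      have e : (Real.log b - Real.log N) / b ^ m + -(Real.log b - Real.log N) / b ^ m = 0 := by
        rw [neg_div]; ring
      linarith [hFb, hFxs, e]
    calc _ ≤ C * (Real.exp (-((m : ℝ) / ((m : ℝ) + 1))) / (((m : ℝ) + 1) * N ^ m) + 1 / ((m : ℝ) ^ 2 * N ^ m)) :=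
          mul_le_mul_of_nonneg_left hsum hC
      _ = R := by rw [hR]; field_simp

/-- **THE CROSS-SUM BOUND, hypothesis only beyond `N`**: for `m ≥ 1`, `N > 0`, `C ≥ 0` with `ψ(x) ≤ C·x` for `x ≥ N`, and every `K`,
`Σ_{n<K} Λ(n)·max 0 (log n − log N)/n^{m+1} ≤ C·(e^{−m/(m+1)}/(m+1) + 1/m²)/N^m`.  RH-FREE bookkeeping. -/
theorem vonMangoldt_logTail_sum_le_of_ge (hm : 1 ≤ m) (hN : 0 < N) (hC : 0 ≤ C)
    (hψ : ∀ x : ℝ, N ≤ x → ψ x ≤ C * x) (K : ℕ) :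
    ∑ n ∈ Finset.range K, (Λ n : ℝ) * max 0 (Real.log n - Real.log N) / (n : ℝ) ^ (m + 1) ≤
      C * (Real.exp (-((m : ℝ) / ((m : ℝ) + 1))) / ((m : ℝ) + 1) + 1 / (m : ℝ) ^ 2) / N ^ m := by
  have hR0 : 0 ≤ C * (Real.exp (-((m : ℝ) / ((m : ℝ) + 1))) / ((m : ℝ) + 1) + 1 / (m : ℝ) ^ 2) / N ^ m := by
    positivity
  -- terms with `n ≤ N` vanish
  have hzero : ∀ n : ℕ, (n : ℝ) ≤ N → (Λ n : ℝ) * max 0 (Real.log n - Real.log N) / (n : ℝ) ^ (m + 1) = 0 := by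
    intro n hn
    rcases Nat.eq_zero_or_pos n with h0 | hpos
    · subst h0; simp
    · have : Real.log n ≤ Real.log N := Real.log_le_log (by exact_mod_cast hpos) hn
      rw [max_eq_left (by linarith)]; simp
  by_cases hK : (K : ℝ) - 1 < N
  · -- every `n < K` has `n ≤ K - 1 < N`
    refine le_trans (le_of_eq (Finset.sum_eq_zero fun n hn ↦ hzero n ?_)) hR0
    have : (n : ℝ) ≤ (K : ℝ) - 1 := by
      have h := Finset.mem_range.1 hn
      have : (n : ℝ) + 1 ≤ K := by exact_mod_cast h
      linarith
    linarith
  · have hK' : N ≤ (K : ℝ) - 1 := le_of_not_gt hK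
    have hK1 : 1 ≤ K := by
      by_contra h
      have : K = 0 := by omega
      subst this; simp at hK'; linarith
    set b : ℝ := ((K - 1 : ℕ) : ℝ) with hb
    have hbK : b = (K : ℝ) - 1 := by rw [hb, Nat.cast_sub hK1]; simp
    have hNb : N ≤ b := by rw [hbK]; exact hK'
    have hfloor : ⌊b⌋₊ = K - 1 := by rw [hb]; exact Nat.floor_natCast _
    have hNfloor : ⌊N⌋₊ ≤ K - 1 := by
      rw [← hfloor]; exact Nat.floor_le_floor hNb
    -- split `range K = Icc 0 (K-1) = Icc 0 ⌊N⌋ ∪ Ioc ⌊N⌋ (K-1)`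
    have hrange : Finset.range K = Finset.Icc 0 ⌊N⌋₊ ∪ Finset.Ioc ⌊N⌋₊ (K - 1) := by
      ext n; simp only [Finset.mem_range, Finset.mem_union, Finset.mem_Icc, Finset.mem_Ioc]; omega
    have hdisj : Disjoint (Finset.Icc 0 ⌊N⌋₊) (Finset.Ioc ⌊N⌋₊ (K - 1)) := by
      rw [Finset.disjoint_left]; intro n h1 h2
      simp only [Finset.mem_Icc, Finset.mem_Ioc] at h1 h2; omega
    rw [hrange, Finset.sum_union hdisj]
    have hfirst : ∑ n ∈ Finset.Icc 0 ⌊N⌋₊, (Λ n : ℝ) * max 0 (Real.log n - Real.log N) / (n : ℝ) ^ (m + 1) = 0 := by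
      refine Finset.sum_eq_zero fun n hn ↦ hzero n ?_
      have : n ≤ ⌊N⌋₊ := (Finset.mem_Icc.1 hn).2
      exact le_trans (by exact_mod_cast this) (Nat.floor_le hN.le)
    have hsecond : ∑ n ∈ Finset.Ioc ⌊N⌋₊ (K - 1), (Λ n : ℝ) * max 0 (Real.log n - Real.log N) / (n : ℝ) ^ (m + 1) =
        ∑ k ∈ Finset.Ioc ⌊N⌋₊ ⌊b⌋₊, (Real.log k - Real.log N) / (k : ℝ) ^ (m + 1) * (Λ k : ℝ) := by
      rw [hfloor]
      refine Finset.sum_congr rfl fun n hn ↦ ?_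
      have hnN : N < n := by
        have : ⌊N⌋₊ < n := (Finset.mem_Ioc.1 hn).1
        exact Nat.lt_of_floor_lt this
      have hn0 : (0 : ℝ) < n := hN.trans hnN
      rw [max_eq_right (by linarith [Real.log_le_log hN hnN.le])]
      ring
    rw [hfirst, zero_add, hsecond]
    exact sum_Ioc_logTail_vonMangoldt_le_of_ge hm hN hNb hC hψ


/-! ## §2 Chebyshev's bound in linear form beyond `N ≥ e²` -/

/-- `log x/√x ≤ log N/√N` for `e² ≤ N ≤ x` (`t ↦ log t/√t` decreases on `[e², ∞)`; elementary: with `x = N·y²`,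
`2 log y ≤ 2(y − 1) ≤ (y − 1)·log N`). [folklore] -/
theorem log_div_sqrt_le_of_ge (hN : Real.exp 2 ≤ N) {x : ℝ} (hx : N ≤ x) :
    Real.log x / Real.sqrt x ≤ Real.log N / Real.sqrt N := by
  have hN0 : 0 < N := (Real.exp_pos 2).trans_le hN
  have hx0 : 0 < x := hN0.trans_le hx
  have hlogN : 2 ≤ Real.log N := by
    have := Real.log_le_log (Real.exp_pos 2) hN
    rwa [Real.log_exp] at this
  have hsN : 0 < Real.sqrt N := Real.sqrt_pos.2 hN0
  have hsx : 0 < Real.sqrt x := Real.sqrt_pos.2 hx0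
  set y : ℝ := Real.sqrt x / Real.sqrt N with hy
  have hy1 : 1 ≤ y := by
    rw [hy, le_div_iff₀ hsN, one_mul]; exact Real.sqrt_le_sqrt hx
  have hy0 : 0 < y := lt_of_lt_of_le one_pos hy1
  have hxy : Real.sqrt x = Real.sqrt N * y := by rw [hy]; field_simp
  have hlogx : Real.log x = Real.log N + 2 * Real.log y := by
    have e1 : x = N * y ^ 2 := by
      have := congrArg (fun z ↦ z ^ 2) hxy
      simp only [mul_pow, Real.sq_sqrt hx0.le, Real.sq_sqrt hN0.le] at this
      exact this
    rw [e1, Real.log_mul hN0.ne' (by positivity), Real.log_pow]; push_cast; ring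
  rw [hlogx, hxy, div_le_div_iff₀ (by positivity) hsN]
  -- `(log N + 2 log y)·√N ≤ log N·(√N·y)` ⟸ `2 log y ≤ (y − 1) log N`
  have hlogy : Real.log y ≤ y - 1 := Real.log_le_sub_one_of_pos hy0
  have key : 2 * Real.log y ≤ (y - 1) * Real.log N := by nlinarith
  nlinarith [key, hsN]

/-- **Chebyshev in linear form beyond `N`**: for `e² ≤ N ≤ x`, `ψ(x) ≤ (log 4 + 2·log N/√N)·x` (Mathlib `Chebyshev.psi_le`
`ψ x ≤ log 4·x + 2√x·log x` and `log x/√x ≤ log N/√N`). UNCONDITIONAL. [folklore; Chebyshev] -/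
theorem psi_le_cheb_linear (hN : Real.exp 2 ≤ N) {x : ℝ} (hx : N ≤ x) :
    ψ x ≤ (Real.log 4 + 2 * (Real.log N / Real.sqrt N)) * x := by
  have hN0 : 0 < N := (Real.exp_pos 2).trans_le hN
  have hx0 : 0 < x := hN0.trans_le hx
  have hN1 : 1 ≤ N := le_trans (by have := Real.add_one_le_exp (2 : ℝ); linarith) hN
  have h1 := Chebyshev.psi_le (le_trans hN1 hx)
  have h2 := log_div_sqrt_le_of_ge hN hx
  have hsx : 0 < Real.sqrt x := Real.sqrt_pos.2 hx0
  -- `2√x·log x = 2·(log x/√x)·x`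
  have e : 2 * Real.sqrt x * Real.log x = 2 * (Real.log x / Real.sqrt x) * x := by
    have hs : Real.sqrt x * Real.sqrt x = x := Real.mul_self_sqrt hx0.le
    have e1 : x / Real.sqrt x = Real.sqrt x := by rw [div_eq_iff hsx.ne', hs]
    calc 2 * Real.sqrt x * Real.log x = 2 * (x / Real.sqrt x) * Real.log x := by rw [e1]
      _ = 2 * (Real.log x / Real.sqrt x) * x := by ring
  rw [e] at h1
  have h3 : 2 * (Real.log x / Real.sqrt x) * x ≤ 2 * (Real.log N / Real.sqrt N) * x := by
    have := mul_le_mul_of_nonneg_right h2 hx0.le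
    linarith
  linarith

/-- The Chebyshev constant is nonnegative for `N ≥ e²` (indeed `≥ log 4`). -/
theorem cheb_const_nonneg (hN : Real.exp 2 ≤ N) : 0 ≤ Real.log 4 + 2 * (Real.log N / Real.sqrt N) := by
  have hN0 : 0 < N := (Real.exp_pos 2).trans_le hN
  have hlogN : 0 ≤ Real.log N := Real.log_nonneg (le_trans (by have := Real.add_one_le_exp (2 : ℝ); linarith) hN)
  have hlog4 : 0 ≤ Real.log 4 := Real.log_nonneg (by norm_num)
  positivity

/-! ## §3 The cross sum, UNCONDITIONALLY -/

/-- **THE CROSS-SUM BOUND WITHOUT ROSSER–SCHOENFELD**: for `m ≥ 1`, `N ≥ e²` and every `K`,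
`Σ_{n<K} Λ(n)·max 0 (log n − log N)/n^{m+1} ≤ (log 4 + 2·log N/√N)·(e^{−m/(m+1)}/(m+1) + 1/m²)/N^m`.
UNCONDITIONAL (Mathlib's Chebyshev bound); RH-FREE bookkeeping. [Chebyshev; THETA-CERT-cc6 §D6] -/
theorem vonMangoldt_logTail_sum_le_cheb (hm : 1 ≤ m) (hN : Real.exp 2 ≤ N) (K : ℕ) :
    ∑ n ∈ Finset.range K, (Λ n : ℝ) * max 0 (Real.log n - Real.log N) / (n : ℝ) ^ (m + 1) ≤
      (Real.log 4 + 2 * (Real.log N / Real.sqrt N)) *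
        (Real.exp (-((m : ℝ) / ((m : ℝ) + 1))) / ((m : ℝ) + 1) + 1 / (m : ℝ) ^ 2) / N ^ m :=
  vonMangoldt_logTail_sum_le_of_ge hm ((Real.exp_pos 2).trans_le hN) (cheb_const_nonneg hN)
    (fun _ hx ↦ psi_le_cheb_linear hN hx) K

end Summit.RiemannHypothesis.RiemannHypothesis.Theorems.WeilColumn.ThetaPrime

end
-- 2026-08-26T07:25Z: byte-identical re-land to refresh the stranded hub olean (ops-buildfix recipe); no content change.
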